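import Literature.MathematicalPhysics.QuantumFieldTheory.Balaban1983to89.NodeOClassTube
import Literature.MathematicalPhysics.QuantumFieldTheory.Balaban1983to89.T4Continuum
import Literature.Analysis.Convex.SchauderFixedPoint

/-!
# `Balaban1983to89.NodeOClassRoad` — THE CLASS ROAD TO THE ENDPOINT: continuity of the β-family on the inter-scale class only, the BROUWER
# step, the datum-level theorem `ClassSpec D → EndpointExistence D.C.toB12`, the comparison with box-wide laws, and a separating family
# (T. Bałaban, CMP **109** (1987) [I] = [Balaban1987RG1] (0.20) p. 256, Thm 2 p. 259, (1.19)–(1.22) pp. 263–264; CMP **119** (1988) [III] =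
# [Balaban1988Convergent] (2.6) p. 255)

statement-level skeleton of published theorems with citation tags; proofs where landed; nothing here is a claim about the Yang–Mills mass gap

CITATION HEADER (lean-in-tree rule).  Ideation cell `ym-nodeO-ideate` (portfolio track), seat P3 «weaken the target», memo `memos/ROUTE-P3.md`
v3.18 §12, LANDING EDITION (generation 18), module 2 of 2 of the β-side «class road» (module 1 = `NodeOClassTube`): §3 ∕ §5 ∕ §6 = the portable
sections :276–:392, :494–:522 (+ :535 `classCont_of_betaContH`) and :565–:686 of the crux line
registered on item stmt-QuantumFields-19181 (`Summits/QuantumFields/YangMills/Cruxes/EndpointGivenB/Lines/class_road.lean`, sha16 af0600b7def32d6e,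
farm rc 0; themselves character-identical to the cell companion `memos/ROUTE-P3-Sketch.lean` §E.8 ∕ §E.10); §4 restates that file's `ClassLaw` ∕
`ClassCont` (:417, :422) for a datum over ANY gauge group `G` (the line file fixes `SU(2)`) and adds `ClassSpec` + the two datum-level consumers.
Declarations and proofs of §3 ∕ §5 ∕ §6 are CHARACTER-IDENTICAL to the cited lines except: namespace, this header, imports ∕ opens, the binder
`{G : Type*} [GaugeGroup G] [MeasurableSpace G] [HaarData G]` replacing `SU2` in `classCont_of_betaContH`, one docstring cross-reference re-worded (§3),
one-line docstrings ADDED to 3 previously undocumented lemmas, a `[cite: …]` tag APPENDED to every docstring (gate rule; the parenthesis in each tag says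
what is NOT claimed).  LABELS in the
docstrings (memo-side words, NOT tree declarations): «(C)» continuity of the β-family, «(D1)» one-loop drift, «(D4)» second-order remainder bound,
«birth line ∕ skeleton» = the crux's first registered skeleton (pub-ymgap plan g59), «companion §…», «`InterScaleMembers` (§C)»,
«`Gaps.BetaContFromD4Chain`», «NODE O ∕ A ∕ B»; «[I]» = [Balaban1987RG1]; «[III]» = [Balaban1988Convergent].

PRINT STATUS (LIT `lit/SOURCES.md` §1.1 ∕ §6).  PRINTED: (0.20) [I] p. 256; Thm 2 [I] p. 259 (UNPROVED in print beyond the announcement, and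
here); the split `β_{k+1} = β⁰_{k+1} + β¹_{k+1}(g_0,…,g_k)`, `β¹ = 0` at `g_k = 0`, and "`β_j` a C^∞-function of `g_{j−1} ∈ [0,γ]`" [I] (1.19)–(1.22)
pp. 263–264 (tree `B12Beta.OneLoopSplit`, `FlowStep.BetaContH`); the inter-scale law (2.6) [III] p. 255.  NOT PRINTED AS SUCH: `BetaContOnClass`,
`BetaContOnInterScale`, `ClassLaw`, `ClassCont`, `ClassSpec` — typed HYPOTHESES on a history-dependent β-family ([folklore] real
analysis over the tree's carriers); every theorem below is an implication between such hypotheses and the tree's `DagBinding.EndpointExistence` ∕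
module 1's `EndpointExistenceWithin`, or a statement about the explicit family `βsep` of §6.

WHAT IS PROVED (sorry-free, axiom-free beyond propext ∕ Classical.choice ∕ Quot.sound).
* §3 `BetaContOnClass`, `continuousOn_backMap_of_contOnClass`, **`exists_run_of_invariant_contOnClass`** (Brouwer — tree
  `Literature.Analysis.Convex.exists_fixedPoint_of_mapsTo_isCompact` — on a compact convex invariant class ⇒ a solution of (0.20) IN the class ending
  at `g`), `BetaContOnInterScale`, **`endpointExistenceWithin_of_interScaleRemainder_contOn`** ∕ `endpointExistence_of_interScaleRemainder_contOn`:
  forward generation + (D1) + (D4) on the class + (C) on the class ⇒ the located END rung ⇒ `DagBinding.EndpointExistence` — NO box-wide upper ∕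
  lower β-bound, NO rate of `β⁰_k`, NO box-wide (D4) or (C) consumed.
* §4 `ClassLaw`, `ClassCont`, `ClassSpec` for `D : T4Continuum.FiniteEpsData F G`; **`endpointExistenceWithin_of_classLaw`**,
  **`endpointExistence_of_classSpec : ClassSpec D → DagBinding.EndpointExistence D.C.toB12`** (forward generation = the datum's own field `D.fwd`).
* §5 box-wide laws imply the class laws: `oneLoopDrift_of_geometric` (rate `c₀θ^k` ⇒ drift `A = c₀∕(1 − θ)`), `interScaleRemainder_of_remainderConst`
  (`r′ = r`), `remainderConst_nonneg`, `classCont_of_betaContH` — the first registered skeleton's box-wide β-hypotheses imply `ClassLaw` ∕ `ClassCont`.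
* §6 STRICT SEPARATION of the binders: the explicit family `βsep` ∕ `Ssep` satisfies (D1), (D4) on the class and (C) on the class (`γ₀ = b = 1`,
  `A = 1∕2`, `r = r′ = 1∕4`) while box-wide `RemainderConst` fails for every `r < 1` and box-wide `BetaContH` fails: **`classRoad_strictly_weaker`**.

WHAT THIS IS NOT.  NOT Thm 2 of [I]; NOT a proof that Bałaban's β-family satisfies `ClassLaw` ∕ `ClassCont` (the open β-side content of the
route's crux, asked of the pinned datum of record); §6 separates HYPOTHESES and says nothing about Bałaban's family; NOT an inhabitant of
`FiniteEpsData`; no node of any plan is claimed closed; finite-ε four-torus bookkeeping only — nothing continuum ∕ ℝ⁴ ∕ OS ∕ mass-gap ∕ Clay.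
NEW file, imports built tree modules only; nothing modified; no `instance`, no `notation`.  Net new unproved facts: 0.
[cite: Balaban1987RG1, (0.20) p.256, Thm 2 p.259, (1.19)-(1.22) pp.263-264; Balaban1988Convergent, (2.6) p.255] -/

noncomputable section

namespace Literature.MathematicalPhysics.QuantumFieldTheory.Balaban1983to89.NodeOClassRoad

open Set Metric
open Literature.MathematicalPhysics.QuantumFieldTheory.Balaban1983to89.FlowStep
open Literature.MathematicalPhysics.QuantumFieldTheory.Balaban1983to89.FlowStepRuns
open Literature.MathematicalPhysics.QuantumFieldTheory.Balaban1983to89.DagBinding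
open Literature.MathematicalPhysics.QuantumFieldTheory.Balaban1983to89.Beta.Drift
open Literature.MathematicalPhysics.QuantumFieldTheory.Balaban1983to89.NodeOClassTube

/-! ## §3  (C) ON THE CLASS ONLY and the located END socket -/

section ContOnClass

open Finset

variable {β : HBeta} {K : ℕ} {lo hi : Fin (K + 1) → ℝ} {γ g : ℝ}

/-- (C) ON A CLASS `T ⊆ ℝ^{K+1}`: `β_j` is continuous on the `j`-prefix coupling histories of the points of `T`, `j < K`
(the only `β_j` the backward map at length `K` evaluates). [cite: Balaban1987RG1, (1.22) p.264 (the continuity sentence after (1.22), typed ON THE CLASS only — a HYPOTHESIS shape, not a statement about the paper)] -/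
def BetaContOnClass (β : HBeta) (K : ℕ) (T : Set (Fin (K + 1) → ℝ)) : Prop :=
  ∀ j, j < K → ContinuousOn (β j) ((fun y : Fin (K + 1) → ℝ => prefixOf (cpl K y) j) '' T)

/-- Box-wide (C) gives (C) on every class inside a tube above `1/γ²`. [cite: Balaban1987RG1, (1.22) p.264 (the continuity sentence after (1.22), typed ON THE CLASS only — a HYPOTHESIS shape, not a statement about the paper)] -/
theorem betaContOnClass_of_betaContH (hγ : 0 < γ) (hlo : ∀ k, 1 / γ ^ 2 ≤ lo k) {T : Set (Fin (K + 1) → ℝ)}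
    (hTsub : T ⊆ Tube K lo hi) (hcont : BetaContH γ β) : BetaContOnClass β K T := fun j _ =>
  (hcont j).mono (by rintro _ ⟨y, hy, rfl⟩; exact prefix_cpl_mem_box hγ hlo (hTsub hy) j)

/-- The backward map is continuous on a class on whose prefix histories `β` is continuous. [cite: Balaban1987RG1, (1.22) p.264 (the continuity sentence after (1.22), typed ON THE CLASS only — a HYPOTHESIS shape, not a statement about the paper)] -/
theorem continuousOn_backMap_of_contOnClass (β : HBeta) (g : ℝ) (hγ : 0 < γ) (hlo : ∀ k, 1 / γ ^ 2 ≤ lo k)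
    {T : Set (Fin (K + 1) → ℝ)} (hTsub : T ⊆ Tube K lo hi) (hcont : BetaContOnClass β K T) :
    ContinuousOn (backMap β K g) T := by
  apply continuousOn_pi.2
  intro k
  show ContinuousOn (fun y => 1 / g ^ 2 + ∑ j ∈ Finset.Ico (k : ℕ) K, β j (prefixOf (cpl K y) j)) _
  refine continuousOn_const.add (continuousOn_finsetSum _ fun j hj => ?_)
  have hin : ContinuousOn (fun y : Fin (K + 1) → ℝ => prefixOf (cpl K y) j) T := by
    apply continuousOn_pi.2
    intro i
    show ContinuousOn (fun y : Fin (K + 1) → ℝ => 1 / Real.sqrt (y (idx K i))) T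
    refine continuousOn_const.div ((continuous_apply (idx K (i : ℕ))).continuousOn.sqrt) fun y hy => ?_
    have hpos : 0 < y (idx K i) := lt_of_lt_of_le (by positivity) ((hlo _).trans ((mem_tube.1 (hTsub hy)) _).1)
    exact (Real.sqrt_pos.2 hpos).ne'
  exact (hcont j (Finset.mem_Ico.1 hj).2).comp hin (Set.mapsTo_image _ _)

/-- **FIXED POINT ON AN INVARIANT COMPACT CONVEX CLASS, (C) ON THE CLASS ONLY** (as `exists_run_of_invariant` :484). [cite: Balaban1987RG1, Thm 2 p.259 (endpoint-existence half reached by a Brouwer fixed point of the backward map on the inter-scale class — [folklore] real analysis under typed hypotheses, not the paper's proof and not an assertion of Thm 2)] -/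
theorem exists_run_of_invariant_contOnClass (β : HBeta) (hg : 0 < g) (hγ : 0 < γ) {T : Set (Fin (K + 1) → ℝ)}
    (hTc : IsCompact T) (hTconv : Convex ℝ T) (hTne : T.Nonempty) (hTsub : T ⊆ Tube K lo hi)
    (hlo : ∀ k, 1 / γ ^ 2 ≤ lo k) (hcont : BetaContOnClass β K T) (hmaps : MapsTo (backMap β K g) T T) :
    ∃ gs : ℕ → ℝ, gs K = g ∧ RGEqH K β gs ∧ Step.InInterval γ K gs ∧
      (fun k : Fin (K + 1) => 1 / gs k ^ 2) ∈ T := by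
  obtain ⟨y, hy, hfix⟩ := Literature.Analysis.Convex.exists_fixedPoint_of_mapsTo_isCompact hTconv
    hTc.isClosed hTne hTc (continuousOn_backMap_of_contOnClass β g hγ hlo hTsub hcont) hmaps hmaps
  have hyT := mem_tube.1 (hTsub hy)
  have hypos : ∀ k, 0 < y k := fun k => lt_of_lt_of_le (by positivity) ((hlo k).trans (hyT k).1)
  have hfixn : ∀ n, n ≤ K → y (idx K n) = 1 / g ^ 2 + ∑ j ∈ Finset.Ico n K, β j (prefixOf (cpl K y) j) := by
    intro n hn
    have h := (congrFun hfix (idx K n)).symm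
    rw [h]
    show 1 / g ^ 2 + ∑ j ∈ Finset.Ico (min n K) K, β j (prefixOf (cpl K y) j) = _
    rw [min_eq_left hn]
  refine ⟨cpl K y, ?_, ?_, ?_, ?_⟩
  · have hK : y (idx K K) = 1 / g ^ 2 := by rw [hfixn K le_rfl, Finset.Ico_self, Finset.sum_empty, add_zero]
    show 1 / Real.sqrt (y (idx K K)) = g
    rw [hK, show (1 : ℝ) / g ^ 2 = (1 / g) ^ 2 by ring, Real.sqrt_sq (by positivity), one_div_one_div]
  · intro k hk
    rw [inv_sq_cpl (hypos _).le, inv_sq_cpl (hypos _).le, hfixn k hk.le, hfixn (k + 1) hk,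
      Finset.sum_eq_sum_Ico_succ_bot hk]
    ring
  · intro k _
    exact ⟨cpl_pos (hypos _), cpl_le hγ ((hlo _).trans (hyT _).1)⟩
  · have : (fun k : Fin (K + 1) => 1 / (cpl K y k) ^ 2) = y := by
      funext k; rw [inv_sq_cpl (hypos _).le, idx_fin]
    rw [this]; exact hy

/-- **(C) ON THE INTER-SCALE CLASSES** with box parameter `γ₀`: continuity of `β_j`, `j < K`, on the `j`-prefix histories of
every admissibly pinned inter-scale tube (`1/g² ≥ 1/γ₀² + 2A`) — i.e. on the histories of `InterScaleMembers` (§C) and on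
nothing else.  This is what the M-test of `Gaps.BetaContFromD4Chain` yields when the (D4) chain's uniform decay is available on
member histories only; box-wide (C) implies it (`betaContOnInterScale_of_betaContH`). [cite: Balaban1987RG1, (1.22) p.264 (the continuity sentence after (1.22), typed ON THE CLASS only — a HYPOTHESIS shape, not a statement about the paper)] -/
def BetaContOnInterScale (β : HBeta) (γ₀ b A r r' : ℝ) : Prop :=
  ∀ g : ℝ, 0 < g → 1 / γ₀ ^ 2 + 2 * A ≤ 1 / g ^ 2 → ∀ K : ℕ, BetaContOnClass β K (InterScaleTube K g b A r r')

/-- Box-wide (C) implies (C) on every admissibly pinned inter-scale class (`r ≤ b`). [cite: Balaban1987RG1, (1.22) p.264 (the continuity sentence after (1.22), typed ON THE CLASS only — a HYPOTHESIS shape, not a statement about the paper)] -/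
theorem betaContOnInterScale_of_betaContH {γ₀ b A r r' : ℝ} (hγ₀ : 0 < γ₀) (hrb : r ≤ b) (hcont : BetaContH γ₀ β) :
    BetaContOnInterScale β γ₀ b A r r' := fun _ _ hgA _ =>
  betaContOnClass_of_betaContH hγ₀ (tubeLo_ge hgA (sub_nonneg.2 hrb)) interScaleTube_subset_afTube hcont

/-- **THE LOCATED SOCKET WITH (C) ON THE CLASS ONLY**: the companion's `endpointExistenceWithin_of_interScaleRemainder` with the
box-wide binder B4 `BetaContH γ₀ β` replaced by `BetaContOnInterScale β γ₀ b A r r′` — so EVERY β-hypothesis of the socket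
((D4) AND (C)) is asked on the inter-scale classes; box-wide remain only forward generation and the history-free drift (D1). [cite: Balaban1987RG1, Thm 2 p.259 (endpoint-existence half reached by a Brouwer fixed point of the backward map on the inter-scale class — [folklore] real analysis under typed hypotheses, not the paper's proof and not an assertion of Thm 2)] -/
theorem endpointExistenceWithin_of_interScaleRemainder_contOn {C : B12.Construction} {β : HBeta}
    (hgen : ForwardGenerated C β) (S : B12Beta.OneLoopSplit β) {γ₀ b A r r' : ℝ} (hγ₀ : 0 < γ₀) (h0r : 0 ≤ r)
    (hrb : r ≤ b) (h0r' : 0 ≤ r') (hdrift : OneLoopDrift b A S.β0) (hcont : BetaContOnInterScale β γ₀ b A r r')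
    (hrem : InterScaleRemainder S γ₀ b A r r') : EndpointExistenceWithin C b A r r' := by
  have hA : 0 ≤ A := hdrift.nonneg
  intro m
  refine ⟨γ₀, hγ₀, fun γ hγ hγle => ?_⟩
  set gstar : ℝ := 1 / Real.sqrt (1 / γ ^ 2 + 2 * A) with hgstar
  have hgstar_pos : 0 < gstar := by positivity
  refine ⟨gstar, hgstar_pos, fun g hg hgle K => ?_⟩
  have hgs : 1 / gstar ^ 2 = 1 / γ ^ 2 + 2 * A := by
    rw [hgstar, div_pow, one_pow, Real.sq_sqrt (by positivity), one_div_one_div]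
  have hgM : 1 / γ ^ 2 + 2 * A ≤ 1 / g ^ 2 := by
    rw [← hgs]; exact one_div_le_one_div_of_le (by positivity) (pow_le_pow_left₀ hg.le hgle 2)
  have hγγ₀ : 1 / γ₀ ^ 2 ≤ 1 / γ ^ 2 := one_div_le_one_div_of_le (by positivity) (pow_le_pow_left₀ hγ.le hγle 2)
  have hgM₀ : 1 / γ₀ ^ 2 + 2 * A ≤ 1 / g ^ 2 := by linarith
  have hlo : ∀ k, 1 / γ ^ 2 ≤ tubeLo g b r A K k := tubeLo_ge hgM (sub_nonneg.2 hrb)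
  have hcont' : BetaContOnClass β K (InterScaleTube K g b A r r') := hcont g hg hgM₀ K
  have hmaps := backMap_mapsTo_interScaleTube (g := g) (K := K) S hdrift
    (fun y hy k hk => hrem g hg hgM₀ K y hy k hk)
  obtain ⟨gs, hgsK, hrg, hI, hmem⟩ := exists_run_of_invariant_contOnClass β hg hγ isCompact_interScaleTube
    convex_interScaleTube (interScaleTube_nonempty hA h0r h0r') interScaleTube_subset_afTube hlo hcont' hmaps
  have heq : ∀ k, k ≤ K → (C ⟨K, m, gs 0⟩).flow.g k = gs k :=
    flow_eq_of_rgEqH (C ⟨K, m, gs 0⟩).flow β K (fun k hk => hgen.2 ⟨K, m, gs 0⟩ k hk)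
      (hgen.1 ⟨K, m, gs 0⟩) hrg (fun k hk => (hI k hk).1)
  refine ⟨gs 0, fun k hk => ?_, ?_, ?_⟩
  · rw [heq k hk]; exact hI k hk
  · rw [heq K le_rfl]; exact hgsK
  · have : (fun k : Fin (K + 1) => 1 / ((C ⟨K, m, gs 0⟩).flow.g k) ^ 2) = fun k : Fin (K + 1) => 1 / gs k ^ 2 := by
      funext k; rw [heq k (Nat.le_of_lt_succ k.isLt)]
    rw [this]; exact hmem

/-- `DagBinding.EndpointExistence` from (D4) AND (C) on the inter-scale classes. [cite: Balaban1987RG1, Thm 2 p.259 (endpoint-existence half reached by a Brouwer fixed point of the backward map on the inter-scale class — [folklore] real analysis under typed hypotheses, not the paper's proof and not an assertion of Thm 2)] -/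
theorem endpointExistence_of_interScaleRemainder_contOn {C : B12.Construction} {β : HBeta}
    (hgen : ForwardGenerated C β) (S : B12Beta.OneLoopSplit β) {γ₀ b A r r' : ℝ} (hγ₀ : 0 < γ₀) (h0r : 0 ≤ r)
    (hrb : r ≤ b) (h0r' : 0 ≤ r') (hdrift : OneLoopDrift b A S.β0) (hcont : BetaContOnInterScale β γ₀ b A r r')
    (hrem : InterScaleRemainder S γ₀ b A r r') : EndpointExistence C :=
  endpointExistence_of_within (endpointExistenceWithin_of_interScaleRemainder_contOn hgen S hγ₀ h0r hrb h0r' hdrift hcont hrem)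

end ContOnClass

/-! ## §4  THE CLASS LAW OF A DATUM and the datum-level consumers -/

section Datum

open T4Continuum

variable {F : T4Family} {G : Type*} [GaugeGroup G] [MeasurableSpace G] [HaarData G]

/-- **THE CLASS LAW** of the datum's history-dependent β-family `D.βfun` with data `(γ₀, b, A, r, r′)` and a one-loop split `S`
(`β_{k+1} = β⁰_{k+1} + β¹_{k+1}(g_0,…,g_k)`, `β¹ = 0` at `g_k = 0` — [Balaban1987RG1] (1.19)–(1.22) p. 264): the history-free
DRIFT `|Σ_{j<k} β⁰_j − b k| ≤ A` (implied by any summable convergence `β⁰_k → b`, in particular by the birth line's geometric rate),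
and the second-order remainder `−r ≤ β¹_{k+1} ≤ r′` asked ONLY at the prefix histories of members of the inter-scale tube pinned at
each admissible target `g` (`1/g² ≥ 1/γ₀² + 2A`), with `0 ≤ r ≤ b`, `0 ≤ r′` (NOT `r ≤ b∕4`; one-sided pair; no β upper∕lower bound).
[cite: Balaban1987RG1, (1.19)-(1.22) pp.263-264; Balaban1988Convergent, (2.6) p.255] -/
def ClassLaw (D : FiniteEpsData F G) (S : B12Beta.OneLoopSplit D.βfun) (γ₀ b A r r' : ℝ) : Prop :=
  0 < γ₀ ∧ 0 ≤ r ∧ r ≤ b ∧ 0 ≤ r' ∧ OneLoopDrift b A S.β0 ∧ InterScaleRemainder S γ₀ b A r r'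

/-- **(C) ON THE CLASS** for the datum's β-family: continuity of `β_j` (`j < K`) on the `j`-prefix histories of the members of every
admissibly pinned inter-scale tube — and nowhere else. [cite: Balaban1987RG1, (1.22) p.264] -/
def ClassCont (D : FiniteEpsData F G) (γ₀ b A r r' : ℝ) : Prop :=
  BetaContOnInterScale D.βfun γ₀ b A r r'

/-- **THE CLASS SPECIFICATION** of a datum: some one-loop split and data `(γ₀, b, A, r, r′)` with the class law and (C) on the class —
the whole β-side content the class road asks of a datum. [cite: Balaban1987RG1, (1.22) p.264 (the second-order remainder `β¹` of the split (1.19)–(1.22), asked on member histories only — a HYPOTHESIS shape, not a statement about the paper)] -/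
def ClassSpec (D : FiniteEpsData F G) : Prop :=
  ∃ (S : B12Beta.OneLoopSplit D.βfun) (γ₀ b A r r' : ℝ), ClassLaw D S γ₀ b A r r' ∧ ClassCont D γ₀ b A r r'

/-- The class law + (C) on the class give the LOCATED END rung for the datum's construction: every small window, every target `g` below
an explicit threshold, every length `K` has a run of `D.C` ending at `g` whose inverse squared couplings are a member of the pinned inter-scale
class (forward generation = the datum's field `D.fwd`). [cite: Balaban1987RG1, Thm 2 p.259 (endpoint-existence half reached by a Brouwer fixed point of the backward map on the inter-scale class — [folklore] real analysis under typed hypotheses, not the paper's proof and not an assertion of Thm 2)] -/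
theorem endpointExistenceWithin_of_classLaw (D : FiniteEpsData F G) {S : B12Beta.OneLoopSplit D.βfun} {γ₀ b A r r' : ℝ}
    (hL : ClassLaw D S γ₀ b A r r') (hC : ClassCont D γ₀ b A r r') : EndpointExistenceWithin D.C.toB12 b A r r' :=
  endpointExistenceWithin_of_interScaleRemainder_contOn D.fwd S hL.1 hL.2.1 hL.2.2.1 hL.2.2.2.1 hL.2.2.2.2.1 hC hL.2.2.2.2.2

/-- **THE DATUM-LEVEL CONSUMER**: `ClassSpec D → DagBinding.EndpointExistence D.C.toB12` — the tree's END leaf for the datum's construction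
from the class specification alone (no box-wide β upper ∕ lower bound, no rate of `β⁰_k`, no box-wide remainder or continuity). [cite: Balaban1987RG1, Thm 2 p.259 (endpoint-existence half reached by a Brouwer fixed point of the backward map on the inter-scale class — [folklore] real analysis under typed hypotheses, not the paper's proof and not an assertion of Thm 2)] -/
theorem endpointExistence_of_classSpec (D : FiniteEpsData F G) (h : ClassSpec D) : EndpointExistence D.C.toB12 := by
  obtain ⟨S, γ₀, b, A, r, r', hL, hC⟩ := h
  exact endpointExistence_of_within (endpointExistenceWithin_of_classLaw D hL hC)

end Datum

/-! ## §5  BOX-WIDE LAWS IMPLY THE CLASS LAWS (the first registered skeleton's β-side hypotheses imply these) -/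

section VersusBox

open Finset T4Continuum

variable {β : HBeta}

/-- (AF-0r) ⇒ DRIFT: a geometric rate `|β⁰_k − β⁰_∞| ≤ c₀θ^k` gives `|Σ_{j<k} β⁰_j − β⁰_∞ k| ≤ c₀/(1 − θ)` for every `k`
(any SUMMABLE rate would do; the drift is all the backward map consumes of the one-loop side). [cite: Balaban1987RG1, (1.3) p.260 and (1.22) p.264 (one-loop part: a summable rate gives the drift form; [folklore])] -/
theorem oneLoopDrift_of_geometric {β0 : ℕ → ℝ} {binf c₀ θ : ℝ} (hc₀ : 0 ≤ c₀) (hθ0 : 0 ≤ θ) (hθ1 : θ < 1)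
    (hconv : ∀ k, |β0 k - binf| ≤ c₀ * θ ^ k) : OneLoopDrift binf (c₀ / (1 - θ)) β0 := by
  intro k
  have hgeom : ∑ j ∈ Finset.range k, θ ^ j ≤ (1 - θ)⁻¹ :=
    sum_le_hasSum (Finset.range k) (fun j _ => pow_nonneg hθ0 j) (hasSum_geometric_of_lt_one hθ0 hθ1)
  have h1 : ∑ j ∈ Finset.range k, β0 j - binf * k = ∑ j ∈ Finset.range k, (β0 j - binf) := by
    rw [Finset.sum_sub_distrib, Finset.sum_const, Finset.card_range, nsmul_eq_mul]; ring
  rw [h1]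
  calc |∑ j ∈ Finset.range k, (β0 j - binf)| ≤ ∑ j ∈ Finset.range k, |β0 j - binf| := Finset.abs_sum_le_sum_abs _ _
    _ ≤ ∑ j ∈ Finset.range k, c₀ * θ ^ j := Finset.sum_le_sum fun j _ => hconv j
    _ = c₀ * ∑ j ∈ Finset.range k, θ ^ j := (Finset.mul_sum _ _ _).symm
    _ ≤ c₀ * (1 - θ)⁻¹ := mul_le_mul_of_nonneg_left hgeom hc₀
    _ = c₀ / (1 - θ) := (div_eq_mul_inv _ _).symm

/-- Box-wide `RemainderConst S γ₀ r` ⇒ (D4) on the pinned inter-scale classes with `r′ = r` (members' prefix histories lie in the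
box `]0,γ₀]` when `r ≤ b`). [cite: Balaban1987RG1, (1.22) p.264 (box-wide hypothesis shapes imply the class shapes; [folklore])] -/
theorem interScaleRemainder_of_remainderConst (S : B12Beta.OneLoopSplit β) {γ₀ b A r : ℝ} (hγ₀ : 0 < γ₀) (hrb : r ≤ b)
    (hrem : Beta.RemainderChain.RemainderConst S γ₀ r) : InterScaleRemainder S γ₀ b A r r := by
  intro g _ hgA K y hy k _
  have hmem : prefixOf (cpl K y) k ∈ Box γ₀ k :=
    prefix_cpl_mem_box hγ₀ (tubeLo_ge hgA (sub_nonneg.2 hrb)) (interScaleTube_subset_afTube hy) k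
  exact abs_le.1 (hrem k _ fun i => (mem_box.1 hmem) i)

/-- A box-wide remainder bound forces `0 ≤ r` (the box is nonempty). [cite: Balaban1987RG1, (1.22) p.264 (box-wide hypothesis shapes imply the class shapes; [folklore])] -/
theorem remainderConst_nonneg (S : B12Beta.OneLoopSplit β) {γ₀ r : ℝ} (hγ₀ : 0 < γ₀)
    (hrem : Beta.RemainderChain.RemainderConst S γ₀ r) : 0 ≤ r :=
  (abs_nonneg _).trans (hrem 0 (fun _ => γ₀) fun _ => ⟨hγ₀, le_rfl⟩)

/-- **BOX-WIDE (C) ⇒ (C) ON THE CLASS.** [cite: Balaban1987RG1, (1.22) p.264 (box-wide hypothesis shapes imply the class shapes; [folklore])] -/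
theorem classCont_of_betaContH {F : T4Family} {G : Type*} [GaugeGroup G] [MeasurableSpace G] [HaarData G] (D : FiniteEpsData F G)
    {γ₀ b A r r' : ℝ} (hγ₀ : 0 < γ₀) (hrb : r ≤ b) (hcont : FlowStep.BetaContH γ₀ D.βfun) : ClassCont D γ₀ b A r r' :=
  betaContOnInterScale_of_betaContH hγ₀ hrb hcont

end VersusBox
/-! ## §6  STRICTLY WEAKER at the level of β-families: a family with the class law and (C) on the class that violates the
birth line's box-wide `RemainderConst` (for every `r < 1 = b`, so a fortiori for `r ≤ b∕4`) AND box-wide `BetaContH`.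
The separation lives on the SHELL `1/g_0² < 1/γ₀² + A` of histories that no inter-scale member pinned at `1/g² ≥ 1/γ₀² + 2A`
visits (`γ₀ = b = 1`, `A = 1/2`, `r = r′ = 1/4`).  It separates the BINDERS; it says nothing about Bałaban's β-family. -/

section Separation

open Classical in
/-- The separating family: `β⁰ ≡ 1`; `β¹_{k+1}(g_0,…,g_k) = 1` on the shell `1/g_0² < 3/2` (switched off at `g_k = 0`, the printed
vanishing), `= 0` elsewhere. [cite: Balaban1987RG1, (1.19)–(1.22) pp.263–264 (an EXPLICIT β-family separating the typed hypothesis shapes; not Bałaban's family, not a statement about the paper)] -/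
def βsep : HBeta := fun k p => 1 + (if 1 / (p 0) ^ 2 < 3 / 2 ∧ p (Fin.last k) ≠ 0 then 1 else 0)

open Classical in
/-- Its one-loop split. [cite: Balaban1987RG1, (1.19)–(1.22) pp.263–264 (an EXPLICIT β-family separating the typed hypothesis shapes; not Bałaban's family, not a statement about the paper)] -/
def Ssep : B12Beta.OneLoopSplit βsep where
  β0 := fun _ => 1
  β1 := fun k p => if 1 / (p 0) ^ 2 < 3 / 2 ∧ p (Fin.last k) ≠ 0 then 1 else 0
  split := fun _ _ => rfl
  vanish := fun k p hp => by simp [hp]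

/-- The separating family has zero drift about `b = 1` with slack `A = 1/2`. [cite: Balaban1987RG1, (1.19)–(1.22) pp.263–264 (an EXPLICIT β-family separating the typed hypothesis shapes; not Bałaban's family, not a statement about the paper)] -/
theorem oneLoopDrift_sep : OneLoopDrift 1 (1 / 2) Ssep.β0 := by
  intro k
  simp [Ssep]

/-- Members of an inter-scale tube pinned at `1/g² ≥ 2` (parameters `b = 1`, `A = 1/2`, `r = r′ = 1/4`) of length `K ≥ 1` have
`1/g_0² ≥ 7/4`: they never visit the shell. [cite: Balaban1987RG1, (1.19)–(1.22) pp.263–264 (an EXPLICIT β-family separating the typed hypothesis shapes; not Bałaban's family, not a statement about the paper)] -/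
theorem sep_member_first {K : ℕ} {g : ℝ} {y : Fin (K + 1) → ℝ} (hg2 : 2 ≤ 1 / g ^ 2)
    (hy : y ∈ InterScaleTube K g 1 (1 / 2) (1 / 4) (1 / 4)) (hK : 1 ≤ K) : 7 / 4 ≤ y (idx K 0) := by
  obtain ⟨hpin, hrun⟩ := mem_interScaleTube.1 hy
  have h := (hrun (idx K 0) (Fin.last K) (Fin.le_last _)).1
  rw [hpin, Fin.val_last, idx_val_of_le (Nat.zero_le K)] at h
  have hK' : (1 : ℝ) ≤ (K : ℝ) := by exact_mod_cast hK
  push_cast at h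
  linarith

/-- On member histories of a tube pinned at `1/g² ≥ 2` the remainder part of the separating family vanishes. [cite: Balaban1987RG1, (1.19)–(1.22) pp.263–264 (an EXPLICIT β-family separating the typed hypothesis shapes; not Bałaban's family, not a statement about the paper)] -/
theorem Ssep_β1_member {K : ℕ} {g : ℝ} {y : Fin (K + 1) → ℝ} (hg2 : 2 ≤ 1 / g ^ 2)
    (hy : y ∈ InterScaleTube K g 1 (1 / 2) (1 / 4) (1 / 4)) {k : ℕ} (hk : k < K) :
    Ssep.β1 k (prefixOf (cpl K y) k) = 0 := by
  have h74 := sep_member_first hg2 hy (by omega)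
  have hy0 : 0 ≤ y (idx K 0) := by linarith
  have hval : prefixOf (cpl K y) k 0 = cpl K y 0 := by simp [prefixOf]
  have hnot : ¬ (1 / (prefixOf (cpl K y) k 0) ^ 2 < 3 / 2 ∧ prefixOf (cpl K y) k (Fin.last k) ≠ 0) := by
    rintro ⟨hlt, -⟩
    rw [hval, inv_sq_cpl hy0] at hlt
    linarith
  dsimp only [Ssep]
  exact if_neg hnot

/-- (D4) ON THE CLASS holds for the separating family (with `β¹ = 0` on every member history). [cite: Balaban1987RG1, (1.19)–(1.22) pp.263–264 (an EXPLICIT β-family separating the typed hypothesis shapes; not Bałaban's family, not a statement about the paper)] -/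
theorem interScaleRemainder_sep : InterScaleRemainder Ssep 1 1 (1 / 2) (1 / 4) (1 / 4) := by
  intro g _ hgA K y hy k hk
  have hg2 : 2 ≤ 1 / g ^ 2 := by norm_num at hgA ⊢; exact hgA
  rw [Ssep_β1_member hg2 hy hk]
  norm_num

/-- (C) ON THE CLASS holds for the separating family (it is constant `= 1` on every member history). [cite: Balaban1987RG1, (1.19)–(1.22) pp.263–264 (an EXPLICIT β-family separating the typed hypothesis shapes; not Bałaban's family, not a statement about the paper)] -/
theorem betaContOnInterScale_sep : BetaContOnInterScale βsep 1 1 (1 / 2) (1 / 4) (1 / 4) := by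
  intro g _ hgA K j hj
  have hg2 : 2 ≤ 1 / g ^ 2 := by norm_num at hgA ⊢; exact hgA
  refine (continuousOn_const (c := (1 : ℝ))).congr ?_
  rintro _ ⟨y, hy, rfl⟩
  show βsep j (prefixOf (cpl K y) j) = 1
  have h : βsep j (prefixOf (cpl K y) j) = 1 + Ssep.β1 j (prefixOf (cpl K y) j) := Ssep.split j _
  rw [h, Ssep_β1_member hg2 hy hj, add_zero]

/-- … but the box-wide remainder bound FAILS for every `r < 1` (the history `g_0 = 1` of length one lies in the box `]0,1]` and on
the shell), so in particular the birth line's `r ≤ β⁰_∞∕4 = 1/4` is violated … [cite: Balaban1987RG1, (1.19)–(1.22) pp.263–264 (an EXPLICIT β-family separating the typed hypothesis shapes; not Bałaban's family, not a statement about the paper)] -/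
theorem not_remainderConst_sep {r : ℝ} (hr : r < 1) : ¬ Beta.RemainderChain.RemainderConst Ssep 1 r := by
  intro h
  have h1 := h 0 (fun _ => (1 : ℝ)) fun _ => ⟨one_pos, le_rfl⟩
  have hval : Ssep.β1 0 (fun _ => (1 : ℝ)) = 1 := by
    dsimp only [Ssep]
    exact if_pos ⟨by norm_num, by norm_num⟩
  rw [hval, abs_one] at h1
  linarith

/-- … and box-wide (C) FAILS (`β_1` jumps across `g_0 = √(2/3)` inside the box `]0,1]`). [cite: Balaban1987RG1, (1.19)–(1.22) pp.263–264 (an EXPLICIT β-family separating the typed hypothesis shapes; not Bałaban's family, not a statement about the paper)] -/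
theorem not_betaContH_sep : ¬ FlowStep.BetaContH 1 βsep := by
  intro h
  set t : ℝ := Real.sqrt (2 / 3) with ht
  have ht0 : 0 < t := Real.sqrt_pos.2 (by norm_num)
  have ht2 : t ^ 2 = 2 / 3 := Real.sq_sqrt (by norm_num)
  have ht1 : t ≤ 1 := by nlinarith
  have hbt : (fun _ : Fin 1 => t) ∈ Box 1 0 := mem_box.2 fun _ => ⟨ht0, ht1⟩
  have hft : βsep 0 (fun _ => t) = 1 := by
    have hn : ¬ (1 / t ^ 2 < 3 / 2 ∧ (fun _ : Fin 1 => t) (Fin.last 0) ≠ 0) := by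
      rintro ⟨hlt, -⟩; rw [ht2] at hlt; norm_num at hlt
    show 1 + (if 1 / t ^ 2 < 3 / 2 ∧ (fun _ : Fin 1 => t) (Fin.last 0) ≠ 0 then (1 : ℝ) else 0) = 1
    rw [if_neg hn, add_zero]
  obtain ⟨δ, hδ, hδc⟩ := Metric.continuousWithinAt_iff.1 (h 0 _ hbt) (1 / 2) (by norm_num)
  set m : ℝ := min 1 (t + δ / 2) with hm
  have hmt : t < m := lt_min (lt_of_le_of_ne ht1 (by
      intro h1; rw [h1] at ht2; norm_num at ht2)) (by linarith)
  have hm0 : 0 < m := ht0.trans hmt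
  have hm1 : m ≤ 1 := min_le_left _ _
  have hbm : (fun _ : Fin 1 => m) ∈ Box 1 0 := mem_box.2 fun _ => ⟨hm0, hm1⟩
  have hdist : dist (fun _ : Fin 1 => m) (fun _ : Fin 1 => t) < δ := by
    refine (dist_pi_lt_iff hδ).2 fun _ => ?_
    rw [Real.dist_eq, abs_of_nonneg (by linarith)]
    have : m ≤ t + δ / 2 := min_le_right _ _
    linarith
  have hfm : βsep 0 (fun _ => m) = 2 := by
    have hm2 : 2 / 3 < m ^ 2 := by rw [← ht2]; exact pow_lt_pow_left₀ hmt ht0.le two_ne_zero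
    have hlt : 1 / m ^ 2 < 3 / 2 := by
      rw [div_lt_iff₀ (by positivity)]; linarith
    have hp : 1 / m ^ 2 < 3 / 2 ∧ (fun _ : Fin 1 => m) (Fin.last 0) ≠ 0 := ⟨hlt, hm0.ne'⟩
    show 1 + (if 1 / m ^ 2 < 3 / 2 ∧ (fun _ : Fin 1 => m) (Fin.last 0) ≠ 0 then (1 : ℝ) else 0) = 2
    rw [if_pos hp]; norm_num
  have := hδc hbm hdist
  rw [hfm, hft, Real.dist_eq] at this
  norm_num at this

/-- **THE SEPARATION**: every β-side hypothesis of this line's stubs holds for `(βsep, Ssep)` with `γ₀ = b = 1`, `A = 1/2`,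
`r = r′ = 1/4` (so `0 ≤ r ≤ b`, `0 ≤ r′`), while the birth line's box-wide `RemainderConst` (any `r < 1`) and box-wide `BetaContH` fail. [cite: Balaban1987RG1, (1.19)–(1.22) pp.263–264 (an EXPLICIT β-family separating the typed hypothesis shapes; not Bałaban's family, not a statement about the paper)] -/
theorem classRoad_strictly_weaker :
    (OneLoopDrift 1 (1 / 2) Ssep.β0 ∧ InterScaleRemainder Ssep 1 1 (1 / 2) (1 / 4) (1 / 4) ∧
        BetaContOnInterScale βsep 1 1 (1 / 2) (1 / 4) (1 / 4)) ∧
      (∀ r < 1, ¬ Beta.RemainderChain.RemainderConst Ssep 1 r) ∧ ¬ FlowStep.BetaContH 1 βsep :=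
  ⟨⟨oneLoopDrift_sep, interScaleRemainder_sep, betaContOnInterScale_sep⟩, fun _ hr => not_remainderConst_sep hr,
    not_betaContH_sep⟩

end Separation

end Literature.MathematicalPhysics.QuantumFieldTheory.Balaban1983to89.NodeOClassRoad

end
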